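import Literature.Geometry.Lorentzian.KerrCarterPointwise
import Literature.Geometry.Lorentzian.KerrTimelikeSpan
import Literature.Geometry.Lorentzian.KerrStationaryBlackHole
import Literature.Geometry.Lorentzian.KerrSchildCoord

/-!
# Pointwise Kerr–Schild facts for `KerrZeroEnergyUntrappedKS`
# (stmt-FinalStateConjecture-13857, route ZeroEnergyKerrOrBomb; helper file)

Kerr–Schild pointwise ingredients of the proof that a zero-energy null geodesic of sub-extremal Kerr
is not trapped modulo the stationary flow (O'Neill 1995, Ch. 4, §4.2; Carter 1968, §IV):

* `KerrUntrapped.bilin_drsrVector_left` — for the Dafermos–Rodnianski–Shlapentokh-Rothman vector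
  `V = ∂_{t*} + ω(r)(x∂_y − y∂_x)` (`Kerr.drsrVector`, timelike on `{r > r₊}`,
  `Kerr.bilin_drsrVector_neg`): `g(V, w) = −E + ω(r) L` with `E = Kerr.ksEnergy`, `L = Kerr.ksAngMom`;
* `KerrUntrapped.eq_zero_of_null_of_ksEnergy_eq_zero_of_ksAngMom_eq_zero` — on `{r > r₊}` a null vector with
  `E = L = 0` vanishes (a non-zero null vector is never orthogonal to the timelike `V`);
* `KerrUntrapped.sq_ksAngMom_le_ksCarterK` — for a null vector with `E = 0` off the horizons, `L² ≤ 𝒦`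
  (Carter's polar bound `(L − a sin²θ E)² ≤ sin²θ 𝒦`, `Kerr.sq_sub_le_sinSq_mul_ksCarterK`);
* `KerrUntrapped.exists_norm_le_of_null` — **uniform control of null vectors by `g(V, ·)` on a radial shell**
  `{r₁ ≤ r ≤ r₂}`, `r₁ > r₊`: `‖w‖ ≤ C |g(V, w)|` for every null `w` (compactness of the null
  directions over the `t* = 0` slice of the shell, `t*`-invariance of `g` and `V`);
* `KerrUntrapped.isCompact_shell` — `{|t*| ≤ T, r₁ ≤ r ≤ r₂}` is a compact subset of the chart domain (as a
  preimage under the inclusion);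
* `KerrUntrapped.exists_radius_bounds_of_stationaryOrbit` — the `∂_{t*}`-orbit of a compact `S ⊆ {r > r₊}`
  lies in a shell `{r₁ ≤ r ≤ r₂}` with `r₁ > r₊`.

## References

* B. O'Neill, *The geometry of Kerr black holes*, A K Peters 1995, Ch. 2, §2.4; Ch. 4, §4.2.
* M. Dafermos, I. Rodnianski, Y. Shlapentokh-Rothman, arXiv:1402.7034, Lemma 4.7.1.
-/

noncomputable section

set_option linter.dupNamespace false
set_option maxSynthPendingDepth 3

namespace Summit.FinalStateConjecture.FinalStateConjecture.Theorems

open Set Filter Metric TopologicalSpace Literature.Geometry.Lorentzian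
open scoped Manifold ContDiff Topology

namespace KerrUntrapped

open Literature.Geometry.Lorentzian.Kerr

variable {M a : ℝ}

/-! ### Algebra of the DRSR vector -/

/-- The axial vector of `KerrTimelikeSpan.lean` is the axial generator of `KerrAxialKillingField.lean`
evaluated at the point: `x₁ ∂₂ − x₂ ∂₁ = J x`. -/
theorem axialVector_eq_axialGenerator (x : E4) : axialVector x = E4.axialGenerator x := by
  rw [E4.axialGenerator_apply]; rfl

/-- `r₊ > 0` for sub-extremal parameters. -/
theorem rPlus_pos (hMa : IsSubextremal M a) : 0 < rPlus M a := by
  unfold rPlus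
  linarith [Real.sqrt_nonneg (M ^ 2 - a ^ 2), hMa.pos]

/-- **`g(V, w) = −E + ω(r) L`** for the DRSR vector `V = ∂_{t*} + ω(r) (x∂_y − y∂_x)` and the
Kerr–Schild Killing energies `E = −g(∂_{t*}, w)`, `L = g(x∂_y − y∂_x, w)`. -/
theorem bilin_drsrVector_left (M a : ℝ) (z w : E4) :
    Kerr.bilin M a z (drsrVector M a z) w =
      -ksEnergy M a z w + drsrAngularVelocity M a (radius a z) * ksAngMom M a z w := by
  unfold drsrVector ksEnergy ksAngMom
  rw [axialVector_eq_axialGenerator, map_add, map_smul]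
  simp only [FunLike.coe_add, FunLike.coe_smul, Pi.add_apply,
    Pi.smul_apply, smul_eq_mul, neg_neg]

/-- The DRSR vector is invariant under `t*`-translations. -/
theorem drsrVector_add_smul_basisVector_zero (M a : ℝ) (z : E4) (t : ℝ) :
    drsrVector M a (z + t • E4.basisVector 0) = drsrVector M a z := by
  have h1 : (z + t • E4.basisVector 0) 1 = z 1 := by simp
  have h2 : (z + t • E4.basisVector 0) 2 = z 2 := by simp
  simp only [drsrVector, radius_add_time_smul_basisVector, axialVector, h1, h2]

/-! ### A null vector with `E = L = 0` vanishes on `{r > r₊}` -/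

/-- **On `{r > r₊}` a null vector orthogonal to both Killing fields vanishes** (sub-extremal Kerr):
`E = L = 0` makes `w` orthogonal to the timelike vector `V = ∂_{t*} + ω(r)Φ`
(`Kerr.bilin_drsrVector_neg`, DRSR Lemma 4.7.1), and a non-zero vector orthogonal to a timelike one
is spacelike (`Kerr.bilin_pos_of_orthogonal`). -/
theorem eq_zero_of_null_of_ksEnergy_eq_zero_of_ksAngMom_eq_zero (hMa : IsSubextremal M a) {z : E4}
    (hz : rPlus M a < radius a z) {w : E4} (hnull : Kerr.bilin M a z w w = 0)
    (hE : ksEnergy M a z w = 0) (hL : ksAngMom M a z w = 0) : w = 0 := by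
  by_contra hw
  have hr : 0 < radius a z := (rPlus_pos hMa).trans hz
  have hVw : Kerr.bilin M a z (drsrVector M a z) w = 0 := by
    rw [bilin_drsrVector_left, hE, hL, neg_zero, mul_zero, add_zero]
  have h := Kerr.bilin_pos_of_orthogonal M a hr _ _ (bilin_drsrVector_neg hMa hz) hVw hw
  linarith

/-! ### Carter: `L² ≤ 𝒦` at zero energy -/

/-- **`L² ≤ 𝒦` for a null vector of zero energy** off the horizons: Carter's polar bound
`(L − a sin²θ E)² ≤ sin²θ 𝒦` (`Kerr.sq_sub_le_sinSq_mul_ksCarterK`) with `E = 0`, `sin²θ ≤ 1` and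
`𝒦 ≥ 0` (`Kerr.ksCarterK_nonneg`). O'Neill 1995, Ch. 4, Thm. 4.2.2 and Cor. 4.2.7. -/
theorem sq_ksAngMom_le_ksCarterK {z : E4} (hz : 0 < radius a z)
    (hΔ : radius a z ^ 2 - 2 * M * radius a z + a ^ 2 ≠ 0) {w : E4}
    (hnull : Kerr.bilin M a z w w = 0) (hE : ksEnergy M a z w = 0) :
    ksAngMom M a z w ^ 2 ≤ ksCarterK M a z w := by
  have hp := sq_sub_le_sinSq_mul_ksCarterK (M := M) hz hΔ hnull
  rw [hE, mul_zero, sub_zero] at hp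
  have hK := ksCarterK_nonneg (M := M) hz hΔ hnull
  have hs : 1 - (z 3 / radius a z) ^ 2 ≤ 1 := by linarith [sq_nonneg (z 3 / radius a z)]
  exact hp.trans (mul_le_of_le_one_left hK hs)

/-! ### Norms in the chart -/

/-- `‖y‖² ≤ (y⁰)² + r² + a²` wherever `r > 0` (`‖y‖² = (y⁰)² + ‖y⃗‖²` and `‖y⃗‖² ≤ r² + a²` from
the defining quartic of the Kerr–Schild radius). -/
theorem norm_sq_le_of_radius_pos {y : E4} (hy : 0 < radius a y) :
    ‖y‖ ^ 2 ≤ y 0 ^ 2 + (radius a y ^ 2 + a ^ 2) := by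
  have hq := radius_quartic a y
  have hr2 : 0 < radius a y ^ 2 := by positivity
  have hs : E4.spatialNorm y ^ 2 ≤ radius a y ^ 2 + a ^ 2 := by
    nlinarith [hq, hr2, sq_nonneg (a * y 3)]
  have hn : ‖y‖ ^ 2 = y 0 ^ 2 + E4.spatialNorm y ^ 2 := by
    rw [EuclideanSpace.norm_sq_eq, Fin.sum_univ_four, E4.spatialNorm_sq]
    simp only [Real.norm_eq_abs, sq_abs]
    ring
  rw [hn]
  linarith

/-- **The slab–shell `{|t*| ≤ T, r₁ ≤ r ≤ r₂}` is compact in `E4`** (closed, by continuity of the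
radius, and bounded, by `norm_sq_le_of_radius_pos`), provided `r₁ > 0`. -/
theorem isCompact_slabShell {r₁ r₂ T : ℝ} (hr₁ : 0 < r₁) :
    IsCompact {y : E4 | |y 0| ≤ T ∧ r₁ ≤ radius a y ∧ radius a y ≤ r₂} := by
  have h0 : Continuous fun y : E4 ↦ y 0 := (EuclideanSpace.proj (𝕜 := ℝ) (0 : Fin 4)).continuous
  have hclosed : IsClosed {y : E4 | |y 0| ≤ T ∧ r₁ ≤ radius a y ∧ radius a y ≤ r₂} :=
    (isClosed_le (continuous_abs.comp h0) continuous_const).inter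
      ((isClosed_le continuous_const (continuous_radius a)).inter
        (isClosed_le (continuous_radius a) continuous_const))
  refine Metric.isCompact_of_isClosed_isBounded hclosed ?_
  refine (Metric.isBounded_iff_subset_closedBall 0).2 ⟨√(T ^ 2 + (r₂ ^ 2 + a ^ 2)), ?_⟩
  rintro y ⟨hT, h₁, h₂⟩
  rw [mem_closedBall_zero_iff]
  have hr : 0 < radius a y := hr₁.trans_le h₁
  refine Real.le_sqrt_of_sq_le ?_
  have h := norm_sq_le_of_radius_pos (a := a) hr
  have hT' : y 0 ^ 2 ≤ T ^ 2 := by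
    have := abs_nonneg (y 0)
    nlinarith [sq_abs (y 0)]
  have hrr : radius a y ^ 2 ≤ r₂ ^ 2 := by nlinarith
  linarith

/-- **The slab–shell is a compact subset of the chart domain `Kerr.region a r₀`** when
`r₁ > max r₀ 0`. -/
theorem isCompact_shell {r₀ r₁ r₂ T : ℝ} (hr₁ : max r₀ 0 < r₁) :
    IsCompact ((Subtype.val : region a r₀ → E4) ⁻¹'
      {y : E4 | |y 0| ≤ T ∧ r₁ ≤ radius a y ∧ radius a y ≤ r₂}) := by
  have hsub : {y : E4 | |y 0| ≤ T ∧ r₁ ≤ radius a y ∧ radius a y ≤ r₂} ⊆ (region a r₀ : Set E4) :=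
    fun y hy ↦ hr₁.trans_le hy.2.1
  have hK := isCompact_slabShell (a := a) (r₂ := r₂) (T := T) ((le_max_right r₀ 0).trans_lt hr₁)
  rw [Subtype.isCompact_iff]
  convert hK using 1
  ext y
  constructor
  · rintro ⟨x, hx, rfl⟩; exact hx
  · intro hy; exact ⟨⟨y, hsub hy⟩, hy, rfl⟩

/-! ### Null vectors are uniformly controlled by `g(V, ·)` on a radial shell -/

/-- **Uniform control of null vectors by `g(V, ·)` on a shell.** For sub-extremal Kerr and radii
`r₊ < r₁`, there is `C` such that at every point `z` of the shell `{r₁ ≤ r ≤ r₂}` every null vector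
`w` satisfies `‖w‖ ≤ C |g(V, w)|`, `V = ∂_{t*} + ω(r)Φ` the DRSR vector. Proof: the set of pairs
`(y, u)` with `y` in the `t* = 0` slice of the shell (compact), `‖u‖ = 1` and `g_y(u, u) = 0` is
compact, and `|g_y(V, u)| > 0` on it (a non-zero null vector is never orthogonal to the timelike
`V`); its positive minimum `m` gives `C = m⁻¹`, after translating `z` to the slice (`g`, `r` and `V`
are `t*`-invariant) and normalising `w`. -/
theorem exists_norm_le_of_null (hMa : IsSubextremal M a) {r₁ : ℝ} (r₂ : ℝ) (hr₁ : rPlus M a < r₁) :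
    ∃ C : ℝ, 0 ≤ C ∧ ∀ (z w : E4), r₁ ≤ radius a z → radius a z ≤ r₂ →
      Kerr.bilin M a z w w = 0 → ‖w‖ ≤ C * |Kerr.bilin M a z (drsrVector M a z) w| := by
  have hrp : 0 < rPlus M a := rPlus_pos hMa
  set K₀ : Set E4 := {y | |y 0| ≤ 0 ∧ r₁ ≤ radius a y ∧ radius a y ≤ r₂} with hK₀
  have hK₀r : ∀ y ∈ K₀, 0 < radius a y := fun y hy ↦ hrp.trans (hr₁.trans_le hy.2.1)
  have hK₀c : IsCompact K₀ := isCompact_slabShell (hrp.trans hr₁)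
  -- continuity of the relevant functions on `K₀ × E4`
  have hB : ContinuousOn (fun p : E4 × E4 ↦ Kerr.bilin M a p.1) (K₀ ×ˢ univ) := fun p hp ↦
    ((contDiffAt_bilin M a (hK₀r p.1 hp.1) (n := 0)).continuousAt.comp
      continuousAt_fst).continuousWithinAt
  have hq : ContinuousOn (fun p : E4 × E4 ↦ Kerr.bilin M a p.1 p.2 p.2) (K₀ ×ˢ univ) :=
    (hB.clm_apply continuousOn_snd).clm_apply continuousOn_snd
  have hω : ContinuousOn (fun p : E4 × E4 ↦ drsrAngularVelocity M a (radius a p.1)) (K₀ ×ˢ univ) := by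
    intro p hp
    have hr : 0 < radius a p.1 := hK₀r p.1 hp.1
    have hc : ContinuousAt (fun r : ℝ ↦ drsrAngularVelocity M a r) (radius a p.1) := by
      unfold drsrAngularVelocity
      have hne : (radius a p.1 ^ 2 + a ^ 2) ^ 2 ≠ 0 := by positivity
      exact ((continuousAt_const.mul continuousAt_id).div (by fun_prop) hne)
    exact (hc.comp (x := p) ((continuous_radius a).comp continuous_fst).continuousAt).continuousWithinAt
  have hax : Continuous fun p : E4 × E4 ↦ axialVector p.1 := by
    unfold axialVector
    fun_prop
  have hV : ContinuousOn (fun p : E4 × E4 ↦ drsrVector M a p.1) (K₀ ×ˢ univ) := by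
    have : (fun p : E4 × E4 ↦ drsrVector M a p.1) = fun p ↦
        E4.basisVector 0 + drsrAngularVelocity M a (radius a p.1) • axialVector p.1 := rfl
    rw [this]
    exact continuousOn_const.add (hω.smul hax.continuousOn)
  have hf : ContinuousOn (fun p : E4 × E4 ↦ |Kerr.bilin M a p.1 (drsrVector M a p.1) p.2|)
      (K₀ ×ˢ univ) :=
    ((hB.clm_apply hV).clm_apply continuousOn_snd).abs
  -- the compact set of null directions over `K₀`
  set N : Set (E4 × E4) := K₀ ×ˢ sphere (0 : E4) 1 ∩
    (fun p : E4 × E4 ↦ Kerr.bilin M a p.1 p.2 p.2) ⁻¹' {0} with hN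
  have hKS : IsCompact (K₀ ×ˢ sphere (0 : E4) 1) := hK₀c.prod (isCompact_sphere 0 1)
  have hsub1 : K₀ ×ˢ sphere (0 : E4) 1 ⊆ K₀ ×ˢ univ := prod_mono subset_rfl (subset_univ _)
  have hNclosed : IsClosed N :=
    (hq.mono hsub1).preimage_isClosed_of_isClosed hKS.isClosed isClosed_singleton
  have hNc : IsCompact N := hKS.of_isClosed_subset hNclosed inter_subset_left
  have hpos : ∀ p ∈ N, 0 < |Kerr.bilin M a p.1 (drsrVector M a p.1) p.2| := by
    rintro ⟨y, u⟩ ⟨⟨hy, hu⟩, hnull⟩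
    have hnull' : Kerr.bilin M a y u u = 0 := hnull
    have hu0 : u ≠ 0 := by
      intro h
      rw [h, mem_sphere_zero_iff_norm, norm_zero] at hu
      exact zero_ne_one hu
    have hyr : rPlus M a < radius a y := hr₁.trans_le hy.2.1
    rw [abs_pos]
    intro h0
    have h := Kerr.bilin_pos_of_orthogonal M a (hK₀r y hy) _ _ (bilin_drsrVector_neg hMa hyr) h0 hu0
    linarith
  obtain ⟨m, hm, hmle⟩ : ∃ m : ℝ, 0 < m ∧
      ∀ p ∈ N, m ≤ |Kerr.bilin M a p.1 (drsrVector M a p.1) p.2| := by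
    rcases N.eq_empty_or_nonempty with hNe | hNne
    · exact ⟨1, one_pos, fun p hp ↦ by simp [hNe] at hp⟩
    · obtain ⟨p₀, hp₀, hmin⟩ :=
        hNc.exists_isMinOn hNne (hf.mono fun p hp ↦ ⟨hp.1.1, mem_univ _⟩)
      exact ⟨_, hpos p₀ hp₀, fun p hp ↦ hmin hp⟩
  refine ⟨m⁻¹, (inv_pos.2 hm).le, fun z w hz₁ hz₂ hnull ↦ ?_⟩
  rcases eq_or_ne w 0 with rfl | hw
  · simp
  -- translate `z` to the slice `t* = 0` and normalise `w`
  set y : E4 := z + (-(z 0)) • E4.basisVector 0 with hy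
  have hy0 : y 0 = 0 := by simp [hy]
  have hry : radius a y = radius a z := radius_add_time_smul_basisVector a z _
  have hby : Kerr.bilin M a y = Kerr.bilin M a z := bilin_add_smul_basisVector_zero M a z _
  have hVy : drsrVector M a y = drsrVector M a z := drsrVector_add_smul_basisVector_zero M a z _
  have hwn : 0 < ‖w‖ := norm_pos_iff.2 hw
  set u : E4 := ‖w‖⁻¹ • w with hu
  have hus : u ∈ sphere (0 : E4) 1 := by
    rw [mem_sphere_zero_iff_norm, hu, norm_smul, norm_inv, norm_norm, inv_mul_cancel₀ hwn.ne']
  have hnullu : Kerr.bilin M a y u u = 0 := by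
    have h' : Kerr.bilin M a y u u = ‖w‖⁻¹ * (‖w‖⁻¹ * Kerr.bilin M a z w w) := by
      simp only [hby, hu, map_smul, smul_eq_mul, FunLike.coe_smul, Pi.smul_apply]
    rw [h', hnull, mul_zero, mul_zero]
  have hmem : (y, u) ∈ N := by
    refine ⟨⟨⟨by rw [hy0, abs_zero], hry.symm ▸ hz₁, hry.symm ▸ hz₂⟩, hus⟩, ?_⟩
    show Kerr.bilin M a y u u ∈ ({0} : Set ℝ)
    rw [hnullu]; exact mem_singleton 0
  have hle := hmle _ hmem
  simp only at hle
  rw [hby, hVy, hu, map_smul, smul_eq_mul, abs_mul, abs_inv, abs_norm] at hle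
  -- `m ≤ ‖w‖⁻¹ |g(V, w)|` gives `‖w‖ ≤ m⁻¹ |g(V, w)|`
  have h1 : m * ‖w‖ ≤ |Kerr.bilin M a z (drsrVector M a z) w| := by
    rw [inv_mul_eq_div] at hle
    exact (le_div_iff₀ hwn).1 hle
  calc ‖w‖ = m⁻¹ * (m * ‖w‖) := by rw [← mul_assoc, inv_mul_cancel₀ hm.ne', one_mul]
    _ ≤ m⁻¹ * |Kerr.bilin M a z (drsrVector M a z) w| :=
      mul_le_mul_of_nonneg_left h1 (inv_pos.2 hm).le

/-! ### The orbit of a compact set off the horizon lies in a radial shell -/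

/-- **The `∂_{t*}`-orbit of a compact `S ⊆ {r > r₊}` lies in a shell `{r₁ ≤ r ≤ r₂}`, `r₁ > r₊`**:
the radius attains its extrema on `S` (compact, non-empty) and is constant along the time translates
which make up the orbit (`Kerr.mem_stationaryOrbit_stationaryField_iff`,
`Kerr.radius_add_time_smul_basisVector`). -/
theorem exists_radius_bounds_of_stationaryOrbit {r₀ : ℝ} {S : Set (region a r₀)} (hS : IsCompact S)
    (hne : S.Nonempty) (hsub : S ⊆ {x : region a r₀ | rPlus M a < radius a x.1}) :
    ∃ r₁ r₂ : ℝ, rPlus M a < r₁ ∧ r₁ ≤ r₂ ∧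
      ∀ y ∈ stationaryOrbit (stationaryField a r₀) S, r₁ ≤ radius a y.1 ∧ radius a y.1 ≤ r₂ := by
  have hc : Continuous fun x : region a r₀ ↦ radius a x.1 :=
    (continuous_radius a).comp continuous_subtype_val
  obtain ⟨x₁, hx₁, hmin⟩ := hS.exists_isMinOn hne hc.continuousOn
  obtain ⟨x₂, hx₂, hmax⟩ := hS.exists_isMaxOn hne hc.continuousOn
  refine ⟨radius a x₁.1, radius a x₂.1, hsub hx₁, hmin hx₂, fun y hy ↦ ?_⟩
  obtain ⟨x, hx, t, rfl⟩ := mem_stationaryOrbit_stationaryField_iff.1 hy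
  rw [coe_timeCurve, radius_add_time_smul_basisVector]
  exact ⟨hmin hx, hmax hx⟩

end KerrUntrapped

end Summit.FinalStateConjecture.FinalStateConjecture.Theorems

end
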